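import Literature.Barriers.FinalStateConjecture.ExtremalHorizonNEnergyBound
import Literature.Geometry.Lorentzian.KerrStarHorizonFluxBound
import HarnessLib

/-!
# The near-horizon `N`-energy of Aretakis's class on extremal Kerr, bounded by the initial energies
# and the transition-slab spacetime integral (Aretakis 2012, §13.1 modulo Thm. 1)

(family `gr`; proving seat of `Literature.Barriers.FinalStateConjecture.Aretakis2012_pointwiseDecay`
— Aretakis, JFA 263 (2012), Thm. 5. This file combines the near-horizon `N`-energy bound with the
zeroth-order terms absorbed (`Kerr.nEnergy_absorbed_box_estimate`, `ExtremalHorizonNEnergyBound.lean`)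
with the control of the flux of `J^{N,−1/2}` through the outer cylinder `{r = 23M/21}` by the
transition slab (`Kerr.StarCoord.outerFlux_nCurrent_le`, `KerrStarHorizonFluxBound.lean`) and the
conserved degenerate `T`-energy (Hardy for the zeroth-order slab terms). The result is the
statement of §13.1 of the source for the class, with the one input the source takes from its
Thm. 1 — the spacetime integral of `(ψ², (∂ψ)²)` over the transition slab
`[t₁, t₂] × {23M/21 ≤ r ≤ 8M/7}` — left explicit on the right-hand side.)

* `Kerr.slabSlice_le_tEnergy` — a slab slice integral of `slabDensity` is `≤ 229 M · E_T(t; [M, R])`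
  when `G` vanishes on the outer cylinder `{r = R}` (Hardy) ;
* `Kerr.nEnergy_slab_box_estimate` (**coordinates**):
  `½ ∫∫_{𝓐_N} e_low(t₂) + ∫_{t₁}^{t₂}∫∫_{𝓐_N} K_low
     ≤ ∫∫_{𝓐_N} E_N(t₁) + 55176 M · E_T(t₁; [M, R]) + (2620/M) ∫_{t₁}^{t₂}∫₀^π∫_{23M/21}^{8M/7} slabDensity`;
* `Kerr.nEnergy_slab_bound_of_class` (**the class**): the same for `G = Φ ∘ κ`, `Φ` smooth at the
  points of an open `U₀ ⊇ {r ≥ M, t* ≥ 0}` of the extremal Kerr region, axisymmetric, solving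
  `□_g ψ = 0` on `U₀`, data supported in `|x| ≤ ρ` on `{t* = 0}`; `R = r₂ > max(ρ, 2M) + 1 + T`,
  `0 ≤ t₁ ≤ t₂ ≤ T`.

Everything is proved; no named facts.

## References

* S. Aretakis, *Decay of axisymmetric solutions of the wave equation on extreme Kerr backgrounds*,
  J. Funct. Anal. 263 (2012) 2770–2831 (arXiv:1110.2006): §13.1 (proof of Thm. 2), Prop. 13.2.1,
  §4.4, Prop. 5.1.2, Prop. 7.2.1, Thm. 1 (key `Aretakis2012`).
-/

noncomputable section

open Real Set Filter MeasureTheory intervalIntegral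
open scoped Topology ContDiff Manifold

namespace Literature.Barriers.FinalStateConjecture.Kerr

open Literature.Geometry.Lorentzian
open Literature.Geometry.Lorentzian.Kerr.StarCoord

/-! ### Coordinate level -/

section Coord

variable {M : ℝ} {W₀ : Set E4} {G : E4 → ℝ}

/-- **A slab slice of `slabDensity` is controlled by the degenerate `T`-energy**: for `G` smooth on
an open `W₀ ⊇ {t} × [M, R] × [0, π]`, `R ≥ 8M/7`, with `G(p(t, R, θ)) = 0`,
`∫₀^π∫_{23M/21}^{8M/7} slabDensity ≤ 229 M ∫₀^π∫_M^R e_T` (the `G²` part by the first Hardy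
inequality, the derivative part pointwise). [cite: Aretakis2012, §13.1] -/
theorem slabSlice_le_tEnergy (hM : 0 < M) (hW₀ : IsOpen W₀) (hG : ContDiffOn ℝ ∞ G W₀)
    {t R φ₀ : ℝ} (hR : 8 / 7 * M ≤ R)
    (hbox : ∀ r ∈ Icc M R, ∀ θ ∈ Icc 0 π, boxPoint φ₀ t r θ ∈ W₀)
    (hfar0 : ∀ θ ∈ Icc 0 π, G (boxPoint φ₀ t R θ) = 0) :
    (∫ θ in (0 : ℝ)..π, ∫ r in (23 / 21 * M)..(8 / 7 * M), slabDensity M G (boxPoint φ₀ t r θ)) ≤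
      229 * M * ∫ θ in (0 : ℝ)..π, ∫ r in M..R, tEnergy M M G (boxPoint φ₀ t r θ) := by
  have hπ : (0 : ℝ) ≤ π := pi_pos.le
  have hMN : M ≤ 23 / 21 * M := by linarith
  have hNR : 23 / 21 * M ≤ 8 / 7 * M := by linarith
  have hMR : M ≤ R := by linarith
  have hboxS : ∀ r ∈ Icc (23 / 21 * M) (8 / 7 * M), ∀ θ ∈ Icc 0 π, boxPoint φ₀ t r θ ∈ W₀ :=
    fun r hr θ hθ ↦ hbox r ⟨hMN.trans hr.1, hr.2.trans hR⟩ θ hθ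
  -- smoothness bookkeeping
  have h0 := contDiffOn_pd hW₀ hG 0
  have h1 := contDiffOn_pd hW₀ hG 1
  have h2 := contDiffOn_pd hW₀ hG 2
  have hc : ∀ j : Fin 4, ContDiffOn ℝ ∞ (fun q : E4 ↦ q j) W₀ := fun j ↦ (Kerr.contDiff_coord j).contDiffOn
  have hsin : ContDiffOn ℝ ∞ (fun q : E4 ↦ sin (q 2)) W₀ := contDiff_sin.comp_contDiffOn (hc 2)
  have sSD : ContDiffOn ℝ ∞ (slabDensity M G) W₀ := by
    unfold slabDensity
    exact hsin.mul (((contDiffOn_const.mul (hG.pow 2)).add (contDiffOn_const.mul ((h0.pow 2).add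
      (h1.pow 2)))).add (contDiffOn_const.mul (h2.pow 2)))
  have sG2 : ContDiffOn ℝ ∞ (fun q ↦ sin (q 2) * G q ^ 2) W₀ := hsin.mul (hG.pow 2)
  have sH : ContDiffOn ℝ ∞ (fun q ↦ 4 * (sin (q 2) * ((q 1 - M) ^ 2 * pd 1 G q ^ 2))) W₀ :=
    contDiffOn_const.mul (hsin.mul ((((hc 1).sub contDiffOn_const).pow 2).mul (h1.pow 2)))
  obtain ⟨sT, -, -⟩ := contDiffOn_tEnergy_tFlux (M := M) (a := M) hW₀ hG
  have sUp : ContDiffOn ℝ ∞ (fun q ↦ M * (sin (q 2) * G q ^ 2) + 221 * M * tEnergy M M G q) W₀ :=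
    (contDiffOn_const.mul sG2).add (contDiffOn_const.mul sT)
  -- (1) pointwise: `slabDensity ≤ M sin θ G² + 221 M e_T` on the slab
  have h1' : (∫ θ in (0 : ℝ)..π, ∫ r in (23 / 21 * M)..(8 / 7 * M), slabDensity M G (boxPoint φ₀ t r θ)) ≤
      ∫ θ in (0 : ℝ)..π, ∫ r in (23 / 21 * M)..(8 / 7 * M),
        (M * (sin ((boxPoint φ₀ t r θ) 2) * G (boxPoint φ₀ t r θ) ^ 2) +
          221 * M * tEnergy M M G (boxPoint φ₀ t r θ)) := by
    refine box2_integral_mono (F := slabDensity M G)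
      (G := fun q ↦ M * (sin (q 2) * G q ^ 2) + 221 * M * tEnergy M M G q) sSD.continuousOn sUp.continuousOn hNR
      hboxS fun r hr θ hθ ↦ ?_
    have hd := slabDensity_deriv_le_tEnergy hM G (q := boxPoint φ₀ t r θ) (by simpa using hr.1) (by simpa using hθ)
    simp only [slabDensity, boxPoint_apply_two] at hd ⊢
    nlinarith [hd]
  have h1s : (∫ θ in (0 : ℝ)..π, ∫ r in (23 / 21 * M)..(8 / 7 * M),
        (M * (sin ((boxPoint φ₀ t r θ) 2) * G (boxPoint φ₀ t r θ) ^ 2) +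
          221 * M * tEnergy M M G (boxPoint φ₀ t r θ))) =
      M * (∫ θ in (0 : ℝ)..π, ∫ r in (23 / 21 * M)..(8 / 7 * M),
        sin ((boxPoint φ₀ t r θ) 2) * G (boxPoint φ₀ t r θ) ^ 2) +
      221 * M * ∫ θ in (0 : ℝ)..π, ∫ r in (23 / 21 * M)..(8 / 7 * M), tEnergy M M G (boxPoint φ₀ t r θ) := by
    rw [box2_integral_add (F := fun q ↦ M * (sin (q 2) * G q ^ 2)) (G := fun q ↦ 221 * M * tEnergy M M G q)
      (contDiffOn_const.mul sG2).continuousOn (contDiffOn_const.mul sT).continuousOn hNR hboxS]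
    simp only [intervalIntegral.integral_const_mul]
  -- (2) the `G²` slab integral: enlarge to `[M, R]`, Hardy, `T`-energy
  have hl : ∀ θ : ℝ, Continuous fun r : ℝ ↦ boxPoint φ₀ t r θ := fun θ ↦
    (continuous_boxPoint φ₀).comp (Continuous.prodMk continuous_const
      (Continuous.prodMk continuous_id continuous_const))
  have h2' : (∫ θ in (0 : ℝ)..π, ∫ r in (23 / 21 * M)..(8 / 7 * M),
      sin ((boxPoint φ₀ t r θ) 2) * G (boxPoint φ₀ t r θ) ^ 2) ≤
      ∫ θ in (0 : ℝ)..π, ∫ r in M..R, sin ((boxPoint φ₀ t r θ) 2) * G (boxPoint φ₀ t r θ) ^ 2 := by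
    refine theta_integral_mono_of_line (F := fun q ↦ sin (q 2) * G q ^ 2) (G := fun q ↦ sin (q 2) * G q ^ 2)
      sG2.continuousOn sG2.continuousOn hNR hMR hboxS hbox fun θ hθ ↦ ?_
    have hco : ContinuousOn (fun r ↦ sin ((boxPoint φ₀ t r θ) 2) * G (boxPoint φ₀ t r θ) ^ 2) (Icc M R) :=
      sG2.continuousOn.comp (hl θ).continuousOn fun r hr ↦ hbox r hr θ hθ
    refine intervalIntegral.integral_mono_interval hMN hNR hR ?_ (hco.intervalIntegrable_of_Icc hMR)
    refine MeasureTheory.ae_of_all _ fun r ↦ ?_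
    simp only [boxPoint_apply_two]
    exact mul_nonneg (sin_nonneg_of_nonneg_of_le_pi hθ.1 hθ.2) (sq_nonneg _)
  have h3' : (∫ θ in (0 : ℝ)..π, ∫ r in M..R, sin ((boxPoint φ₀ t r θ) 2) * G (boxPoint φ₀ t r θ) ^ 2) ≤
      ∫ θ in (0 : ℝ)..π, ∫ r in M..R, 4 * (sin ((boxPoint φ₀ t r θ) 2) *
        (((boxPoint φ₀ t r θ) 1 - M) ^ 2 * pd 1 G (boxPoint φ₀ t r θ) ^ 2)) := by
    refine theta_integral_mono_of_line (F := fun q ↦ sin (q 2) * G q ^ 2)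
      (G := fun q ↦ 4 * (sin (q 2) * ((q 1 - M) ^ 2 * pd 1 G q ^ 2)))
      sG2.continuousOn sH.continuousOn hMR hMR hbox hbox fun θ hθ ↦ ?_
    simp only [boxPoint_apply_two, boxPoint_apply_one]
    rw [intervalIntegral.integral_const_mul, intervalIntegral.integral_const_mul,
      intervalIntegral.integral_const_mul]
    have hH := line_sq_le_hardy hW₀ hG hMR (fun r hr ↦ hbox r hr θ hθ) (hfar0 θ hθ) (φ₀ := φ₀)
    have hs : 0 ≤ sin θ := sin_nonneg_of_nonneg_of_le_pi hθ.1 hθ.2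
    nlinarith [mul_le_mul_of_nonneg_left hH hs]
  have h4' : (∫ θ in (0 : ℝ)..π, ∫ r in M..R, 4 * (sin ((boxPoint φ₀ t r θ) 2) *
        (((boxPoint φ₀ t r θ) 1 - M) ^ 2 * pd 1 G (boxPoint φ₀ t r θ) ^ 2))) ≤
      ∫ θ in (0 : ℝ)..π, ∫ r in M..R, 8 * tEnergy M M G (boxPoint φ₀ t r θ) := by
    refine box2_integral_mono (F := fun q ↦ 4 * (sin (q 2) * ((q 1 - M) ^ 2 * pd 1 G q ^ 2)))
      (G := fun q ↦ 8 * tEnergy M M G q) sH.continuousOn (contDiffOn_const.mul sT).continuousOn hMR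
      hbox fun r hr θ hθ ↦ ?_
    have hs : 0 ≤ sin θ := sin_nonneg_of_nonneg_of_le_pi hθ.1 hθ.2
    have hrM : M ≤ r := hr.1
    simp only [tEnergy, boxPoint_apply_one, boxPoint_apply_two]
    nlinarith [mul_nonneg hs (mul_nonneg (by nlinarith [sq_nonneg (cos θ)] :
      (0 : ℝ) ≤ r ^ 2 + M ^ 2 * cos θ ^ 2 + 2 * M * r) (sq_nonneg (pd 0 G (boxPoint φ₀ t r θ)))),
      mul_nonneg hs (sq_nonneg (pd 2 G (boxPoint φ₀ t r θ)))]
  have h4s : (∫ θ in (0 : ℝ)..π, ∫ r in M..R, 8 * tEnergy M M G (boxPoint φ₀ t r θ)) =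
      8 * ∫ θ in (0 : ℝ)..π, ∫ r in M..R, tEnergy M M G (boxPoint φ₀ t r θ) := by
    simp only [intervalIntegral.integral_const_mul]
  -- (3) the `T`-energy slab integral: enlarge to `[M, R]`
  have h5' : (∫ θ in (0 : ℝ)..π, ∫ r in (23 / 21 * M)..(8 / 7 * M), tEnergy M M G (boxPoint φ₀ t r θ)) ≤
      ∫ θ in (0 : ℝ)..π, ∫ r in M..R, tEnergy M M G (boxPoint φ₀ t r θ) := by
    refine theta_integral_mono_of_line (F := tEnergy M M G) (G := tEnergy M M G)
      sT.continuousOn sT.continuousOn hNR hMR hboxS hbox fun θ hθ ↦ ?_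
    have hco : ContinuousOn (fun r ↦ tEnergy M M G (boxPoint φ₀ t r θ)) (Icc M R) :=
      sT.continuousOn.comp (hl θ).continuousOn fun r hr ↦ hbox r hr θ hθ
    refine intervalIntegral.integral_mono_interval hMN hNR hR ?_ (hco.intervalIntegrable_of_Icc hMR)
    refine ae_restrict_of_forall_mem measurableSet_Ioc fun r hr ↦ ?_
    have hs : 0 ≤ sin θ := sin_nonneg_of_nonneg_of_le_pi hθ.1 hθ.2
    have hrM : M ≤ r := hr.1.le
    simp only [tEnergy, boxPoint_apply_one, boxPoint_apply_two]
    have hΔ : (0 : ℝ) ≤ r ^ 2 - 2 * M * r + M ^ 2 := by nlinarith [sq_nonneg (r - M)]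
    have hS : (0 : ℝ) ≤ r ^ 2 + M ^ 2 * cos θ ^ 2 + 2 * M * r := by nlinarith [sq_nonneg (cos θ)]
    positivity
  -- assemble
  have hT0 : 0 ≤ ∫ θ in (0 : ℝ)..π, ∫ r in M..R, tEnergy M M G (boxPoint φ₀ t r θ) := by
    refine intervalIntegral.integral_nonneg hπ fun θ hθ ↦ intervalIntegral.integral_nonneg hMR fun r hr ↦ ?_
    have hs : 0 ≤ sin θ := sin_nonneg_of_nonneg_of_le_pi hθ.1 hθ.2
    have hrM : M ≤ r := hr.1
    simp only [tEnergy, boxPoint_apply_one, boxPoint_apply_two]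
    have hΔ : (0 : ℝ) ≤ r ^ 2 - 2 * M * r + M ^ 2 := by nlinarith [sq_nonneg (r - M)]
    have hS : (0 : ℝ) ≤ r ^ 2 + M ^ 2 * cos θ ^ 2 + 2 * M * r := by nlinarith [sq_nonneg (cos θ)]
    positivity
  rw [h1s] at h1'
  rw [h4s] at h4'
  have hG2 : M * (∫ θ in (0 : ℝ)..π, ∫ r in (23 / 21 * M)..(8 / 7 * M),
      sin ((boxPoint φ₀ t r θ) 2) * G (boxPoint φ₀ t r θ) ^ 2) ≤
      M * (8 * ∫ θ in (0 : ℝ)..π, ∫ r in M..R, tEnergy M M G (boxPoint φ₀ t r θ)) :=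
    mul_le_mul_of_nonneg_left (by linarith) hM.le
  have hTE : 221 * M * (∫ θ in (0 : ℝ)..π, ∫ r in (23 / 21 * M)..(8 / 7 * M), tEnergy M M G (boxPoint φ₀ t r θ)) ≤
      221 * M * ∫ θ in (0 : ℝ)..π, ∫ r in M..R, tEnergy M M G (boxPoint φ₀ t r θ) :=
    mul_le_mul_of_nonneg_left h5' (by positivity)
  nlinarith [hG2, hTE, h1']

/-- **The near-horizon `N`-energy estimate with the outer flux controlled by the transition slab
(coordinates).** For `G` smooth on an open `W₀ ⊇ [t₁, t₂] × [M, R] × [0, π]`, `R ≥ 8M/7`, with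
`𝓡G + 𝓐G = 0` off the axis and `G`, `∂G` vanishing on the outer cylinder `{r = R}`:
`½ ∫∫_{𝓐_N} e_low(t₂) + ∫_{t₁}^{t₂}∫∫_{𝓐_N} K_low
   ≤ ∫∫_{𝓐_N} E_N(t₁) + 55176 M · E_T(t₁; [M, R]) + (2620/M) ∫_{t₁}^{t₂}∫₀^π∫_{23M/21}^{8M/7} slabDensity`.
[cite: Aretakis2012, §13.1] -/
theorem nEnergy_slab_box_estimate (hM : 0 < M) (hW₀ : IsOpen W₀) (hG : ContDiffOn ℝ ∞ G W₀)
    (hP : ∀ q ∈ W₀, sin (q 2) ≠ 0 → radOp M M G q + angOp M G q = 0)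
    {t₁ t₂ R φ₀ : ℝ} (ht : t₁ ≤ t₂) (hR : 8 / 7 * M ≤ R)
    (hbox : ∀ t ∈ Icc t₁ t₂, ∀ r ∈ Icc M R, ∀ θ ∈ Icc 0 π, boxPoint φ₀ t r θ ∈ W₀)
    (hfar0 : ∀ t ∈ Icc t₁ t₂, ∀ θ ∈ Icc 0 π, G (boxPoint φ₀ t R θ) = 0)
    (hfar1 : ∀ t ∈ Icc t₁ t₂, ∀ θ ∈ Icc 0 π, ∀ i, pd i G (boxPoint φ₀ t R θ) = 0) :
    1 / 2 * (∫ θ in (0 : ℝ)..π, ∫ r in M..(23 / 21 * M), nEnergyLower M G (boxPoint φ₀ t₂ r θ)) +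
        (∫ t in t₁..t₂, ∫ θ in (0 : ℝ)..π, ∫ r in M..(23 / 21 * M), nBulkLower M G (boxPoint φ₀ t r θ)) ≤
      (∫ θ in (0 : ℝ)..π, ∫ r in M..(23 / 21 * M),
          -multDensity M M (nProfileR M) (nProfileT M) nProfileW G (boxPoint φ₀ t₁ r θ)) +
        55176 * M * (∫ θ in (0 : ℝ)..π, ∫ r in M..R, tEnergy M M G (boxPoint φ₀ t₁ r θ)) +
        2620 / M * ∫ t in t₁..t₂, ∫ θ in (0 : ℝ)..π, ∫ r in (23 / 21 * M)..(8 / 7 * M),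
          slabDensity M G (boxPoint φ₀ t r θ) := by
  have hπ : (0 : ℝ) ≤ π := pi_pos.le
  have hNR : 23 / 21 * M ≤ R := by linarith
  have hMR : M ≤ R := by linarith
  have ht₁ : t₁ ∈ Icc t₁ t₂ := left_mem_Icc.mpr ht
  have ht₂ : t₂ ∈ Icc t₁ t₂ := right_mem_Icc.mpr ht
  -- (O): the absorbed estimate with the outer flux explicit
  have hO := nEnergy_absorbed_box_estimate hM hW₀ hG hP ht hNR hbox (hfar0 t₂ ht₂) hfar1
  -- (P): the outer flux controlled by the slab
  have hboxS : ∀ t ∈ Icc t₁ t₂, ∀ r ∈ Icc (23 / 21 * M) (8 / 7 * M), ∀ θ ∈ Icc 0 π, boxPoint φ₀ t r θ ∈ W₀ :=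
    fun t ht' r hr θ hθ ↦ hbox t ht' r ⟨by linarith [hr.1], hr.2.trans hR⟩ θ hθ
  have hPf := outerFlux_nCurrent_le hM hW₀ hG hP ht hboxS
  -- slices by the `T`-energy, and the `T`-energy is non-increasing
  have hS1 := slabSlice_le_tEnergy hM hW₀ hG hR (hbox t₁ ht₁) (hfar0 t₁ ht₁) (φ₀ := φ₀)
  have hS2 := slabSlice_le_tEnergy hM hW₀ hG hR (hbox t₂ ht₂) (hfar0 t₂ ht₂) (φ₀ := φ₀)
  have hfarT : ∀ t ∈ Icc t₁ t₂, ∀ θ ∈ Icc (0 : ℝ) π, tFluxR M M G (boxPoint φ₀ t R θ) = 0 := by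
    intro t ht' θ hθ
    simp only [tFluxR, hfar1 t ht' θ hθ, mul_zero, add_zero, zero_pow two_ne_zero]
  have h5 := (tEnergy_extremal_antitone hW₀ hG hP ht hMR hbox hfarT).1
  have hS2' : (∫ θ in (0 : ℝ)..π, ∫ r in (23 / 21 * M)..(8 / 7 * M), slabDensity M G (boxPoint φ₀ t₂ r θ)) ≤
      229 * M * ∫ θ in (0 : ℝ)..π, ∫ r in M..R, tEnergy M M G (boxPoint φ₀ t₁ r θ) :=
    hS2.trans (mul_le_mul_of_nonneg_left h5 (by positivity))
  linarith

end Coord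

/-! ### The class -/

variable [Kerr.Facts] [Kerr.SliceFacts] {M r₀ : ℝ} {U₀ : Set (Kerr.region M r₀)} {Φ : E4 → ℝ}

/-- **The near-horizon `N`-energy of Aretakis's class, bounded by the initial energies and the
transition-slab spacetime integral (§13.1 of the source modulo its Thm. 1).** For `Φ` smooth at the
points of an open `U₀ ⊇ {r ≥ M, t* ≥ 0}` of the extremal Kerr region (`a = M > 0`), invariant under
the axial rotations (where `r_BL > 0`), solving `□_g ψ = 0` on `U₀`, with `ψ, dψ` vanishing for
`|x| > ρ` on `{t* = 0} ∩ U₀`, and `0 ≤ t₁ ≤ t₂ ≤ T`, `r₂ > max(ρ, 2M) + 1 + T`: with `G = Φ ∘ κ`,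
`½ ∫∫_{𝓐_N} e_low(t₂) + ∫_{t₁}^{t₂}∫∫_{𝓐_N} K_low
   ≤ ∫∫_{𝓐_N} E_N(t₁) + 55176 M ∫₀^π∫_M^{r₂} e_T(t₁) + (2620/M) ∫_{t₁}^{t₂}∫₀^π∫_{23M/21}^{8M/7} slabDensity`.
The last term — the spacetime integral of `sin θ (M G² + M³((∂_{t*}G)² + (∂_rG)²) + M(∂_θG)²)` over
the transition slab — is the quantity bounded (uniformly in `t₂`) by the integrated local energy
decay estimate, Thm. 1 of the source. [cite: Aretakis2012, §13.1 and Thm. 1–2] -/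
theorem nEnergy_slab_bound_of_class (hM : 0 < M) (hr₀ : r₀ ∈ Set.Ioo 0 M) (hU₀ : IsOpen U₀)
    (hKU : {x : Kerr.region M r₀ | Kerr.rPlus M M ≤ Kerr.radius M (x : E4) ∧ 0 ≤ (x : E4) 0} ⊆ U₀)
    (hΦ : ∀ x ∈ U₀, ContDiffAt ℝ ∞ Φ x)
    (haxi : ∀ (β : ℝ) (z : E4), 0 < Kerr.radius M z → Φ (E4.axialRotation β z) = Φ z)
    (hsol : ∀ x ∈ U₀, (Kerr.smoothMetric M M r₀).toPseudoRiemannianMetric.dalembertian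
      (fun y : Kerr.region M r₀ ↦ Φ y) x = 0)
    {ρ : ℝ} (hloc : ∀ x ∈ U₀, (x : E4) 0 = 0 → ρ < E4.spatialNorm (x : E4) → Φ x = 0 ∧ fderiv ℝ Φ x = 0)
    {t₁ t₂ T r₂ φ₀ : ℝ} (ht₁ : 0 ≤ t₁) (ht : t₁ ≤ t₂) (hT : t₂ ≤ T) (hr₂ : max ρ (2 * M) + 1 + T < r₂) :
    1 / 2 * (∫ θ in (0 : ℝ)..π, ∫ r in M..(23 / 21 * M),
        nEnergyLower M (Kerr.starPull M Φ) (boxPoint φ₀ t₂ r θ)) +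
        (∫ t in t₁..t₂, ∫ θ in (0 : ℝ)..π, ∫ r in M..(23 / 21 * M),
          nBulkLower M (Kerr.starPull M Φ) (boxPoint φ₀ t r θ)) ≤
      (∫ θ in (0 : ℝ)..π, ∫ r in M..(23 / 21 * M),
          -multDensity M M (nProfileR M) (nProfileT M) nProfileW (Kerr.starPull M Φ) (boxPoint φ₀ t₁ r θ)) +
        55176 * M * (∫ θ in (0 : ℝ)..π, ∫ r in M..r₂, tEnergy M M (Kerr.starPull M Φ) (boxPoint φ₀ t₁ r θ)) +
        2620 / M * ∫ t in t₁..t₂, ∫ θ in (0 : ℝ)..π, ∫ r in (23 / 21 * M)..(8 / 7 * M),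
          slabDensity M (Kerr.starPull M Φ) (boxPoint φ₀ t r θ) := by
  obtain ⟨hr₀pos, hr₀M⟩ := hr₀
  have hR : 8 / 7 * M ≤ r₂ := by
    have : 2 * M ≤ max ρ (2 * M) := le_max_right _ _
    linarith [ht₁, ht, hT]
  have hMr₂ : M ≤ r₂ := by linarith
  -- the coordinate open set and the separated equation off the axis
  set V : Set E4 := Subtype.val '' U₀ with hVdef
  have hV : IsOpen V := (Kerr.region M r₀).isOpen.isOpenMap_subtype_val U₀ hU₀
  have hΦV : ∀ z ∈ V, ContDiffAt ℝ ∞ Φ z := by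
    rintro _ ⟨y, hyU, rfl⟩; exact hΦ y hyU
  set W₀ : Set E4 := {q : E4 | 0 < q 1 ∧ Kerr.starChart M q ∈ V} with hW₀def
  have hW₀ : IsOpen W₀ := (isOpen_lt continuous_const (PiLp.continuous_apply 2 _ 1)).inter
    (hV.preimage (Kerr.contDiff_starChart M (n := 0)).continuous)
  have hG : ContDiffOn ℝ ∞ (Kerr.starPull M Φ) W₀ := fun q hq ↦
    (Kerr.contDiffAt_comp_starChart (hΦV _ hq.2)).contDiffWithinAt
  obtain ⟨-, -, -, hsep, -⟩ := separated_equations_starPull hU₀ hΦ haxi hsol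
  have hP : ∀ q ∈ W₀, Real.sin (q 2) ≠ 0 →
      radOp M M (Kerr.starPull M Φ) q + angOp M (Kerr.starPull M Φ) q = 0 :=
    fun q hq hs ↦ hsep q ⟨hq.1, hs, hq.2⟩
  -- the box lies in `W₀`
  have hK'reg : ∀ x : E4, Kerr.rPlus M M ≤ Kerr.radius M x ∧ 0 ≤ x 0 → x ∈ Kerr.region M r₀ := by
    intro x hx
    rw [Kerr.mem_region]
    have h1 := hx.1
    rw [Kerr.rPlus_self] at h1
    exact max_lt (by linarith) (by linarith)
  have hbox : ∀ t ∈ Icc t₁ t₂, ∀ r ∈ Icc M r₂, ∀ θ ∈ Icc 0 π, boxPoint φ₀ t r θ ∈ W₀ := by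
    intro t ht' r hr' θ _
    have hK := shellPoint_mem_horizonFutureSet hM (ht₁.trans ht'.1) hr'.1 θ φ₀
    refine ⟨hM.trans_le hr'.1, ?_⟩
    rw [starChart_boxPoint]
    exact ⟨⟨_, hK'reg _ hK⟩, hKU hK, rfl⟩
  -- far-field vanishing on the outer cylinder
  have hfar : ∀ t ∈ Icc t₁ t₂, ∀ θ : ℝ, Kerr.starPull M Φ (boxPoint φ₀ t r₂ θ) = 0 ∧
      ∀ i, pd i (Kerr.starPull M Φ) (boxPoint φ₀ t r₂ θ) = 0 := by
    intro t ht' θ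
    obtain ⟨hΦ0, hdΦ0⟩ := fderiv_shellPoint_eq_zero_of_far hM ⟨hr₀pos, hr₀M⟩ hU₀ hKU hΦ hsol hloc hr₂
      (ht₁.trans ht'.1) (ht'.2.trans hT) θ φ₀
    have hK := shellPoint_mem_horizonFutureSet hM (ht₁.trans ht'.1) hMr₂ θ φ₀
    have hq : boxPoint φ₀ t r₂ θ ∈ W₀ := by
      refine ⟨hM.trans_le hMr₂, ?_⟩
      rw [starChart_boxPoint]
      exact ⟨⟨_, hK'reg _ hK⟩, hKU hK, rfl⟩
    have hd : DifferentiableAt ℝ Φ (shellPoint M t r₂ θ φ₀) := by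
      rw [← starChart_boxPoint]; exact (hΦV _ hq.2).differentiableAt (by simp)
    refine ⟨?_, fun i ↦ ?_⟩
    · rw [Kerr.starPull_apply, starChart_boxPoint]; exact hΦ0
    · rw [pd_starPull_boxPoint hd, hdΦ0]; rfl
  exact nEnergy_slab_box_estimate hM hW₀ hG hP ht hR hbox
    (fun t ht' θ _ ↦ (hfar t ht' θ).1) (fun t ht' θ _ i ↦ (hfar t ht' θ).2 i)



end Literature.Barriers.FinalStateConjecture.Kerr

end
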